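import Summits.MatrixMultiplication.OmegaCensus.STPPFatQuotientLift
import Summits.MatrixMultiplication.OmegaCensus.STPPSmallPatternT1K7OrderLaw
import Summits.MatrixMultiplication.OmegaCensus.STPPSmallPatternT1K6OrderLaw
import Summits.MatrixMultiplication.OmegaCensus.STPPSmallPatternT1K8OrderLaw
import Summits.MatrixMultiplication.OmegaCensus.STPPSmallPatternT2K6OrderLaw
import Mathlib.GroupTheory.Perm.Cycle.Type
import Mathlib.Data.ZMod.QuotientGroup

/-!
# ω-census, small STPP patterns: the EVEN-ORDER LIFT LAWS («T1 host law at `N` ⇒ T2 hosts at every even order `≥ 2N`»)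

HONEST FRAMING (pub-omega census; verbatim): lottery ticket; floor = certified bounds/negative ranges.
Census STRUCTURE bookkeeping of the STPP track (seat pub-omega-stpp-3, gen 26; STRUCTURE row B5, columns `T2` / `(2,2,2)^k`, §2 C10 clause (c)),
not progress on `ω`: small patterns in small groups bound no exponent.

The tree's FAT LIFT (`STPPFatQuotientLift.lean`, ENG2 gen 31): along a surjective additive hom `q : G → Q` whose kernel has order `2`,
`(2,1,1)^k ⊆ Q ⇒ (1,2,2)^k ⊆ G` (`exists_isSTPP_122_of_211_of_surjective`) and `(1,2,2)^k ⊆ Q ⇒ (2,2,2)^k ⊆ G`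
(`exists_isSTPP_222_of_122_of_surjective`).  Every finite abelian group of EVEN order has an element `t` of order `2` (Cauchy), and
`G → G/⟨t⟩` is such a surjection with `|G/⟨t⟩| = |G|/2`.  Hence the GENERIC LAWS of this file (no search, no `decide`):

* `exists_isSTPP_122_of_even_card_of_law` — if every finite abelian group of order `≥ N` hosts `(2,1,1)^k`, then every finite abelian
  group of even order `≥ 2N` hosts `(1,2,2)^k`;
* `exists_isSTPP_211_of_even_card_of_law` — the same one storey down (`(1,1,1)^k`, i.e. tricolored sum-free families, to `(2,1,1)^k`);
* `exists_isSTPP_222_of_four_dvd_card_of_law` — two storeys: a `(2,1,1)^k` host law at `N` puts `(2,2,2)^k` in every finite abelian group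
  whose order is divisible by `4` and `≥ 4N`.

INSTANCES with the tree's kernel `T1` host laws (ENG2 gen 33: `exists_isSTPP_211pow6_of_card_ge_30`, `exists_isSTPP_211pow7_of_card_ge_38`):
* `k = 7`: **every finite abelian group of even order `≥ 76` hosts `(1,2,2)⁷`** (`exists_isSTPP_122pow7_of_even_card_ge_76`) — the even half of
  the `T2` host law at `k = 7` (cyclic column of record: `ℤ/m` hosts for every `m ≥ 76` except possibly `77, 79`);
* `k = 6`: every finite abelian group of even order `≥ 60` hosts `(1,2,2)⁶`; with the odd orders `≥ 65` covered by the host law «order `≥ 64`»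
  (`exists_isSTPP_122pow6_of_card_ge_64`, stpp-3 gen 25): **every finite abelian group of order `≥ 60` other than `61` and `63` hosts `(1,2,2)⁶`**
  (`exists_isSTPP_122pow6_of_card_ge_60_of_ne`) — §2 C10 clause (c) at `k = 6` is thereby kernel for every `n ≥ 60` except exactly the odd
  orders `61` (`ℤ/61`) and `63` (`ℤ/63`, `ℤ/3 × ℤ/21`);
* `(2,2,2)^k`: every finite abelian group of order divisible by `4` and `≥ 120` hosts `(2,2,2)⁶`, and `≥ 152` hosts `(2,2,2)⁷`;
* `k = 8` (§4, appended): every finite abelian group of even order `≥ 96` hosts `(1,2,2)⁸` (ENG2's `(2,1,1)⁸` law at `48`, lifted), and every one of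
  order divisible by `4` and `≥ 192` hosts `(2,2,2)⁸`.

References: H. Cohn, R. Kleinberg, B. Szegedy, C. Umans, FOCS 2005 (arXiv:math/0511460), Def. 5.1 and §7.
-/

open Literature.Computability.AlgebraicComplexity Finset

namespace Summit.MatrixMultiplication.OmegaCensus

universe u

/-! ## 1. An element of order two and its quotient -/

/-- The zero fibre of the quotient map `G → G/H`, counted over `G`, has `|H|` elements. [folklore] -/
theorem card_filter_quotient_mk'_eq_zero {G : Type u} [AddCommGroup G] [Fintype G] (H : AddSubgroup G)
    [DecidableEq (G ⧸ H)] : ((univ : Finset G).filter (fun g => QuotientAddGroup.mk' H g = 0)).card = Nat.card H := by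
  classical
  have hset : ((univ : Finset G).filter (fun g => QuotientAddGroup.mk' H g = 0)) = (H : Set G).toFinset := by
    ext g
    simp [QuotientAddGroup.eq_zero_iff]
  rw [hset, ← Nat.card_eq_card_toFinset]
  rfl

/-- In a finite abelian group of even order there is a subgroup of order `2` (generated by an element of order `2`, Cauchy), and the
quotient by it has order `|G|/2`. [folklore] -/
theorem exists_addSubgroup_card_two {G : Type u} [AddCommGroup G] [Finite G] (heven : Even (Nat.card G)) :
    ∃ H : AddSubgroup G, Nat.card H = 2 ∧ Nat.card G = Nat.card (G ⧸ H) * 2 := by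
  haveI : Fact (Nat.Prime 2) := ⟨Nat.prime_two⟩
  obtain ⟨t, ht⟩ := exists_prime_addOrderOf_dvd_card' (G := G) 2 (even_iff_two_dvd.1 heven)
  have h2 : Nat.card (AddSubgroup.zmultiples t) = 2 := by rw [Nat.card_zmultiples, ht]
  refine ⟨AddSubgroup.zmultiples t, h2, ?_⟩
  have h := AddSubgroup.card_eq_card_quotient_mul_card_addSubgroup (AddSubgroup.zmultiples t)
  rw [h2] at h
  exact h

/-! ## 2. The generic even-order lift laws -/

/-- **EVEN-ORDER LIFT LAW, `T1 → T2`.** If every finite abelian group of order `≥ N` hosts an STPP family of size pattern `(2,1,1)^k`, then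
every finite abelian group of even order `≥ 2N` hosts one of size pattern `(1,2,2)^k` (Cauchy + the tree's fat lift
`exists_isSTPP_122_of_211_of_surjective`). [cite: CohnKleinbergSzegedyUmans2005, Def. 5.1] -/
theorem exists_isSTPP_122_of_even_card_of_law {k N : ℕ}
    (hlaw : ∀ (Q : Type u) [AddCommGroup Q] [Finite Q], N ≤ Nat.card Q →
      ∃ A B C : Fin k → Finset Q, IsSTPP A B C ∧ ∀ i, (A i).card = 2 ∧ (B i).card = 1 ∧ (C i).card = 1)
    {G : Type u} [AddCommGroup G] [Finite G] (heven : Even (Nat.card G)) (hG : 2 * N ≤ Nat.card G) :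
    ∃ A B C : Fin k → Finset G, IsSTPP A B C ∧ ∀ i, (A i).card = 1 ∧ (B i).card = 2 ∧ (C i).card = 2 := by
  classical
  haveI := Fintype.ofFinite G
  obtain ⟨H, h2, hcard⟩ := exists_addSubgroup_card_two (G := G) heven
  exact exists_isSTPP_122_of_211_of_surjective (QuotientAddGroup.mk' H) (QuotientAddGroup.mk'_surjective H)
    (by rw [card_filter_quotient_mk'_eq_zero, h2]) (hlaw (G ⧸ H) (by omega))

/-- **EVEN-ORDER LIFT LAW, `TSF → T1`.** If every finite abelian group of order `≥ N` hosts an STPP family of singletons of size `k`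
(a tricolored sum-free set, size pattern `(1,1,1)^k`), then every finite abelian group of even order `≥ 2N` hosts `(2,1,1)^k`
(`exists_isSTPP_211_of_111_of_surjective`). [cite: CohnKleinbergSzegedyUmans2005, Def. 5.1] -/
theorem exists_isSTPP_211_of_even_card_of_law {k N : ℕ}
    (hlaw : ∀ (Q : Type u) [AddCommGroup Q] [Finite Q], N ≤ Nat.card Q →
      ∃ A B C : Fin k → Finset Q, IsSTPP A B C ∧ ∀ i, (A i).card = 1 ∧ (B i).card = 1 ∧ (C i).card = 1)
    {G : Type u} [AddCommGroup G] [Finite G] (heven : Even (Nat.card G)) (hG : 2 * N ≤ Nat.card G) :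
    ∃ A B C : Fin k → Finset G, IsSTPP A B C ∧ ∀ i, (A i).card = 2 ∧ (B i).card = 1 ∧ (C i).card = 1 := by
  classical
  haveI := Fintype.ofFinite G
  obtain ⟨H, h2, hcard⟩ := exists_addSubgroup_card_two (G := G) heven
  exact exists_isSTPP_211_of_111_of_surjective (QuotientAddGroup.mk' H) (QuotientAddGroup.mk'_surjective H)
    (by rw [card_filter_quotient_mk'_eq_zero, h2]) (hlaw (G ⧸ H) (by omega))

/-- **EVEN-ORDER LIFT LAW, `T2 → (2,2,2)`.** If every finite abelian group of EVEN order `≥ N` hosts `(1,2,2)^k`, then every finite abelian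
group of order divisible by `4` and `≥ 2N` hosts `(2,2,2)^k` (`exists_isSTPP_222_of_122_of_surjective`; the quotient by an element of order
`2` of a group of order `4m` has even order `2m`). [cite: CohnKleinbergSzegedyUmans2005, Def. 5.1] -/
theorem exists_isSTPP_222_of_four_dvd_card_of_even_law {k N : ℕ}
    (hlaw : ∀ (Q : Type u) [AddCommGroup Q] [Finite Q], Even (Nat.card Q) → N ≤ Nat.card Q →
      ∃ A B C : Fin k → Finset Q, IsSTPP A B C ∧ ∀ i, (A i).card = 1 ∧ (B i).card = 2 ∧ (C i).card = 2)
    {G : Type u} [AddCommGroup G] [Finite G] (h4 : 4 ∣ Nat.card G) (hG : 2 * N ≤ Nat.card G) :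
    ∃ A B C : Fin k → Finset G, IsSTPP A B C ∧ ∀ i, (A i).card = 2 ∧ (B i).card = 2 ∧ (C i).card = 2 := by
  classical
  haveI := Fintype.ofFinite G
  have heven : Even (Nat.card G) := even_iff_two_dvd.2 (dvd_trans ⟨2, rfl⟩ h4)
  obtain ⟨H, h2, hcard⟩ := exists_addSubgroup_card_two (G := G) heven
  have hQeven : Even (Nat.card (G ⧸ H)) := by
    obtain ⟨c, hc⟩ := h4
    refine even_iff_two_dvd.2 ⟨c, ?_⟩
    omega
  exact exists_isSTPP_222_of_122_of_surjective (QuotientAddGroup.mk' H) (QuotientAddGroup.mk'_surjective H)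
    (by rw [card_filter_quotient_mk'_eq_zero, h2]) (hlaw (G ⧸ H) hQeven (by omega))

/-- **TWO STOREYS, `T1 → (2,2,2)`.** If every finite abelian group of order `≥ N` hosts `(2,1,1)^k`, then every finite abelian group of order
divisible by `4` and `≥ 4N` hosts `(2,2,2)^k`. [cite: CohnKleinbergSzegedyUmans2005, Def. 5.1] -/
theorem exists_isSTPP_222_of_four_dvd_card_of_law {k N : ℕ}
    (hlaw : ∀ (Q : Type u) [AddCommGroup Q] [Finite Q], N ≤ Nat.card Q →
      ∃ A B C : Fin k → Finset Q, IsSTPP A B C ∧ ∀ i, (A i).card = 2 ∧ (B i).card = 1 ∧ (C i).card = 1)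
    {G : Type u} [AddCommGroup G] [Finite G] (h4 : 4 ∣ Nat.card G) (hG : 4 * N ≤ Nat.card G) :
    ∃ A B C : Fin k → Finset G, IsSTPP A B C ∧ ∀ i, (A i).card = 2 ∧ (B i).card = 2 ∧ (C i).card = 2 :=
  exists_isSTPP_222_of_four_dvd_card_of_even_law (N := 2 * N)
    (fun Q _ _ hQe hQ => exists_isSTPP_122_of_even_card_of_law hlaw hQe hQ) h4 (by omega)

/-! ## 3. Instances: `k = 7` and `k = 6` -/

/-- **`k = 7`, EVEN HALF OF THE HOST LAW: every finite abelian group of even order `≥ 76` hosts `(1,2,2)⁷`** (ENG2's `(2,1,1)⁷` host law at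
`38`, lifted).  No onset and no `iff` is claimed; no `ω` bound follows. [cite: CohnKleinbergSzegedyUmans2005, Def. 5.1] -/
theorem exists_isSTPP_122pow7_of_even_card_ge_76 {G : Type u} [AddCommGroup G] [Finite G] (heven : Even (Nat.card G))
    (hG : 76 ≤ Nat.card G) :
    ∃ A B C : Fin 7 → Finset G, IsSTPP A B C ∧ ∀ i, (A i).card = 1 ∧ (B i).card = 2 ∧ (C i).card = 2 :=
  exists_isSTPP_122_of_even_card_of_law (N := 38) (fun Q _ _ hQ => exists_isSTPP_211pow7_of_card_ge_38 hQ) heven (by omega)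

/-- **`k = 6`, even orders: every finite abelian group of even order `≥ 60` hosts `(1,2,2)⁶`** (ENG2's `(2,1,1)⁶` host law at `30`, lifted);
in particular all eleven abelian groups of order `60`, `62` (cf. ENG2's `…T2K6Order60`). [cite: CohnKleinbergSzegedyUmans2005, Def. 5.1] -/
theorem exists_isSTPP_122pow6_of_even_card_ge_60 {G : Type u} [AddCommGroup G] [Finite G] (heven : Even (Nat.card G))
    (hG : 60 ≤ Nat.card G) :
    ∃ A B C : Fin 6 → Finset G, IsSTPP A B C ∧ ∀ i, (A i).card = 1 ∧ (B i).card = 2 ∧ (C i).card = 2 :=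
  exists_isSTPP_122_of_even_card_of_law (N := 30) (fun Q _ _ hQ => exists_isSTPP_211pow6_of_card_ge_30 hQ) heven (by omega)

/-- **`k = 6`, THE SHARPENED HOST LAW: every finite abelian group of order `≥ 60`, other than the odd orders `61` and `63`, hosts `(1,2,2)⁶`**
(even orders by the lift, odd orders `≥ 65` by the host law «order `≥ 64`» of stpp-3 gen 25).  The orders `61` (`ℤ/61`) and `63` (`ℤ/63`,
`ℤ/3 × ℤ/21`) are exactly the cells left open by the census (GO #109 LIFT6X); nothing is claimed about them.
[cite: CohnKleinbergSzegedyUmans2005, Def. 5.1] -/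
theorem exists_isSTPP_122pow6_of_card_ge_60_of_ne {G : Type u} [AddCommGroup G] [Finite G] (hG : 60 ≤ Nat.card G)
    (h61 : Nat.card G ≠ 61) (h63 : Nat.card G ≠ 63) :
    ∃ A B C : Fin 6 → Finset G, IsSTPP A B C ∧ ∀ i, (A i).card = 1 ∧ (B i).card = 2 ∧ (C i).card = 2 := by
  rcases Nat.even_or_odd (Nat.card G) with he | ho
  · exact exists_isSTPP_122pow6_of_even_card_ge_60 he hG
  · obtain ⟨m, hm⟩ := ho
    exact exists_isSTPP_122pow6_of_card_ge_64 (by omega)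

/-- **`(2,2,2)⁶` two storeys up: every finite abelian group of order divisible by `4` and `≥ 120` hosts `(2,2,2)⁶`.**
[cite: CohnKleinbergSzegedyUmans2005, Def. 5.1] -/
theorem exists_isSTPP_222pow6_of_four_dvd_card_ge_120 {G : Type u} [AddCommGroup G] [Finite G] (h4 : 4 ∣ Nat.card G)
    (hG : 120 ≤ Nat.card G) :
    ∃ A B C : Fin 6 → Finset G, IsSTPP A B C ∧ ∀ i, (A i).card = 2 ∧ (B i).card = 2 ∧ (C i).card = 2 :=
  exists_isSTPP_222_of_four_dvd_card_of_law (N := 30) (fun Q _ _ hQ => exists_isSTPP_211pow6_of_card_ge_30 hQ) h4 (by omega)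

/-- **`(2,2,2)⁷` two storeys up: every finite abelian group of order divisible by `4` and `≥ 152` hosts `(2,2,2)⁷`.**
[cite: CohnKleinbergSzegedyUmans2005, Def. 5.1] -/
theorem exists_isSTPP_222pow7_of_four_dvd_card_ge_152 {G : Type u} [AddCommGroup G] [Finite G] (h4 : 4 ∣ Nat.card G)
    (hG : 152 ≤ Nat.card G) :
    ∃ A B C : Fin 7 → Finset G, IsSTPP A B C ∧ ∀ i, (A i).card = 2 ∧ (B i).card = 2 ∧ (C i).card = 2 :=
  exists_isSTPP_222_of_four_dvd_card_of_law (N := 38) (fun Q _ _ hQ => exists_isSTPP_211pow7_of_card_ge_38 hQ) h4 (by omega)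

/-! ## 4. Instances: `k = 8` (appended 2026-08-28, after ENG2's `(2,1,1)⁸` host law at `48`, `exists_isSTPP_211pow8_of_card_ge_48`) -/

/-- **`k = 8`, EVEN HALF OF THE HOST LAW: every finite abelian group of even order `≥ 96` hosts `(1,2,2)⁸`** (ENG2's `(2,1,1)⁸` host law at `48`,
lifted).  No onset and no `iff` is claimed (cyclic cells `97, 99` are odd and outside this statement). [cite: CohnKleinbergSzegedyUmans2005, Def. 5.1] -/
theorem exists_isSTPP_122pow8_of_even_card_ge_96 {G : Type u} [AddCommGroup G] [Finite G] (heven : Even (Nat.card G))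
    (hG : 96 ≤ Nat.card G) :
    ∃ A B C : Fin 8 → Finset G, IsSTPP A B C ∧ ∀ i, (A i).card = 1 ∧ (B i).card = 2 ∧ (C i).card = 2 :=
  exists_isSTPP_122_of_even_card_of_law (N := 48) (fun Q _ _ hQ => exists_isSTPP_211pow8_of_card_ge_48 hQ) heven (by omega)

/-- **`(2,2,2)⁸` two storeys up: every finite abelian group of order divisible by `4` and `≥ 192` hosts `(2,2,2)⁸`.**
[cite: CohnKleinbergSzegedyUmans2005, Def. 5.1] -/
theorem exists_isSTPP_222pow8_of_four_dvd_card_ge_192 {G : Type u} [AddCommGroup G] [Finite G] (h4 : 4 ∣ Nat.card G)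
    (hG : 192 ≤ Nat.card G) :
    ∃ A B C : Fin 8 → Finset G, IsSTPP A B C ∧ ∀ i, (A i).card = 2 ∧ (B i).card = 2 ∧ (C i).card = 2 :=
  exists_isSTPP_222_of_four_dvd_card_of_law (N := 48) (fun Q _ _ hQ => exists_isSTPP_211pow8_of_card_ge_48 hQ) h4 (by omega)

end Summit.MatrixMultiplication.OmegaCensus
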